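import Literature.AlgebraicGeometry.Frobenioids.ArithmeticFrobenioidThm64ivTransport
import Literature.AlgebraicGeometry.Frobenioids.ArithmeticFrobenioidThm64ivNormPreservation
import Literature.AlgebraicGeometry.Frobenioids.Cor54SubTransportProofs
import Literature.AlgebraicGeometry.Frobenioids.Cor54SubRealSpanCompatProofs
import Literature.AlgebraicGeometry.Frobenioids.Prop53SubProofs
import HarnessLib

/-!
# Frobenioids I, Theorem 6.4 (iv): "if the equivalence `Ψ^rlf` of (ii) ARISES FROM an equivalence `Ψ : C₁ ⥲ C₂`"
# — THE realified equivalence induced by `Ψ` at the constructions `C_i = C_{K_i/F_i}` (sub-DAG row T64iv/L01,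
# compatibility with `Ψ^rlf`; Cor. 5.4 at the arithmetic Frobenioids)

Mochizuki, *The geometry of Frobenioids I: the general theory*, Kyushu J. Math. **62** (2008) 293–400, §6,
Thm. 6.4 (iv) p. 115 l. 17–19 ("If the equivalence of categories `Ψ^rlf` of (ii) arises from an equivalence of
categories `Ψ : C₁ ⥲ C₂` [cf. (i); (iii); Theorem 3.4, (iii), (iv)], then `deg(Ψ^rlf) = 1`"), Cor. 5.4 p. 104
("there exists a 1-unique functor `Ψ^rlf : C₁^rlf → C₂^rlf` … Corollary 5.4 follows immediately from Corollaries
4.10; 4.11, (iii), (iv)") [cite: MochizukiFrdI2008, Thm. 6.4 (iv) p.115].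

PROOF-ONLY file (cell abc-iut, `plan/L1/SUBDAG-FrdI-Thm64.md` §G row **T64iv/L01**, field "compatibility with
`Ψ^rlf` [Cor. 5.4]"; L1-lead R108 (4) row (G) (S5); seat abc-iut-L1-d7).  At THE arithmetic Frobenioids and THEIR
realifications `C_{K/F}^rlf = PreFrobenioid.rlf (ModelFrobenioid.toElem …) hΦ` (abc-iut-L1-d2 / w5-d137's W3
sub-DAG vocabulary `FrdI.Cor54Sub.*`), GIVEN the typed conclusion of [FrdI] Cor. 4.11 (iv) for `Ψ` (binder `h411iv`,
cone node FrdI:Cor4.11(iv); its premises hold at `C_{K/F}`, `ArithmeticFrobenioidThm64ivTransport.lean`):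
* (inputs from `ArithmeticFrobenioidThm64ivNormPreservation.lean`: `arith_thm34ii_preserves` — [FrdI] Thm. 3.4 (ii)
  for every equivalence of arithmetic Frobenioids — and `arith_biratCompat_of_cor411iv` — `Ψ^Φ` carries
  `Φ₁^birat(X)` onto `Φ₂^birat(Ψ^Base X)`, row C54/L03;)
* `exists_rlfTransport_of_cor411iv` — **THE `Ψ^rlf` induced by `Ψ`**: with `(Ψ^Φ)^rlf := FrdI.Cor54Sub.rlfIso … E`
  (abc-iut-w5-d137, row C54/L02) carrying `ℝ · Φ₁^birat` onto `ℝ · Φ₂^birat` (row C54/L04 `realSpanCompat_holds`), the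
  model-level transport of row C54/L05 (`rlfTransport_holds`) is an EQUIVALENCE `Ψ^rlf : C₁^rlf ⥲ C₂^rlf` lying over
  `Ψ^Base`, preserving Frobenius degrees and carrying divisors by `(Ψ^Φ)^rlf`; and `(Ψ^Φ)^rlf` extends `Ψ^Φ` along
  `Φ_i ↪ Φ_i^rlf`, so it carries THE GENERATOR `ι δ_w` to `ι δ_{π w}` (generator ↦ generator of row T64iv/L01,
  `ArithmeticDivisorsMonoidIsoPlaces.lean`).  This is the datum the degree relation of Thm. 6.4 (ii) (row (E),
  abc-iut-w4-d086) is read at in the composition T64iv/L08 (`MotivatingExamplesThm64ivDegOne.lean`).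
No definitions, no named facts; nothing here bears on [IUTchIII] Cor. 3.12 or asserts anything about abc.
-/

noncomputable section

namespace Literature.AlgebraicGeometry.Frobenioids

open CategoryTheory Opposite NumberField
open Literature.AnabelianGeometry.EtaleTheta

section Arith

variable {F₁ : Type} [Field F₁] [NumberField F₁] {K₁ : Type} [Field K₁] [Algebra F₁ K₁] [IsGalois F₁ K₁]
variable {F₂ : Type} [Field F₂] [NumberField F₂] {K₂ : Type} [Field K₂] [Algebra F₂ K₂] [IsGalois F₂ K₂]

/-! ### THE realified equivalence induced by `Ψ` -/

/-- **Thm. 6.4 (iv): "the equivalence of categories `Ψ^rlf` … arises from an equivalence `Ψ : C₁ ⥲ C₂`" — THE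
`Ψ^rlf` at the constructions, with its transport datum read at generators.**  For an equivalence
`Ψ : C_{K₁/F₁} ⥲ C_{K₂/F₂}` with the typed conclusion of Cor. 4.11 (iv) (binder `h411iv`) and any perf-factoriality
witnesses `hΦ_i` of the divisor monoids (the realifications `C_i^rlf := PreFrobenioid.rlf … hΦ_i`): there are
`Ψ^Base` (an equivalence), `Ψ^Φ = E` with `η`, the bijections `π_X` of finite places with `Ψ^Φ_X δ_w = δ_{π_X w}`,
and an EQUIVALENCE `Ψ^rlf : C₁^rlf ⥲ C₂^rlf` lying over `Ψ^Base` (`ηrlf`), preserving Frobenius degrees and carrying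
divisors by `(Ψ^Φ)^rlf := FrdI.Cor54Sub.rlfIso … E` (Cor. 5.4), which extends `Ψ^Φ` along `ι : Φ_i → Φ_i^rlf` and
hence carries `ι δ_w` to `ι δ_{π_X w}`. [cite: MochizukiFrdI2008, Thm. 6.4 (iv) p.115] -/
theorem exists_rlfTransport_of_cor411iv (Ψ : arithFrobenioid F₁ K₁ ≌ arithFrobenioid F₂ K₂)
    (hΦ₁ : PreFrobenioid.IsPerfFactorialOn (arithDivisorFunctor F₁ K₁))
    (hΦ₂ : PreFrobenioid.IsPerfFactorialOn (arithDivisorFunctor F₂ K₂))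
    (h411iv : PreFrobenioidData.Cor411iv (arithFrobenioidOps F₁ K₁) (arithFrobenioidOps F₂ K₂) Ψ
      (PreFrobenioid.rsParams (arithFrobenioid_isFrobenioid F₁ K₁) fun a 𝔭 => PrimarySupp a 𝔭)
      (PreFrobenioid.rsParams (arithFrobenioid_isFrobenioid F₂ K₂) fun a 𝔭 => PrimarySupp a 𝔭)) :
    ∃ (ΨBase : FinSubextCat F₁ K₁ ⥤ FinSubextCat F₂ K₂)
      (E : PreFrobenioidData.DivisorMonoidIsoOverBase (arithFrobenioidOps F₁ K₁) (arithFrobenioidOps F₂ K₂) ΨBase)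
      (_ : Ψ.functor ⋙ (arithFrobenioidOps F₂ K₂).base ≅ (arithFrobenioidOps F₁ K₁).base ⋙ ΨBase)
      (π : ∀ X : FinSubextCat F₁ K₁, FinitePlace X.L ≃ FinitePlace (ΨBase.obj X).L)
      (Ψrlf : PreFrobenioid.rlf
          (ModelFrobenioid.toElem (arithDivisorFunctor F₁ K₁) (unitsFunctor F₁ K₁) (divNatTrans F₁ K₁)) hΦ₁ ⥤
        PreFrobenioid.rlf
          (ModelFrobenioid.toElem (arithDivisorFunctor F₂ K₂) (unitsFunctor F₂ K₂) (divNatTrans F₂ K₂)) hΦ₂)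
      (ηrlf : Ψrlf ⋙ (FrdI.Cor54Sub.rlfData
          (ModelFrobenioid.toElem (arithDivisorFunctor F₂ K₂) (unitsFunctor F₂ K₂) (divNatTrans F₂ K₂)) hΦ₂).base ≅
        (FrdI.Cor54Sub.rlfData
          (ModelFrobenioid.toElem (arithDivisorFunctor F₁ K₁) (unitsFunctor F₁ K₁) (divNatTrans F₁ K₁)) hΦ₁).base ⋙
          ΨBase),
      ΨBase.IsEquivalence ∧ Ψrlf.IsEquivalence ∧
      (∀ (X : FinSubextCat F₁ K₁) (w : FinitePlace X.L),
        E.iso X (Multiplicative.ofAdd (EffArithDivisor.single X.L (Sum.inr w))) =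
          Multiplicative.ofAdd (EffArithDivisor.single (ΨBase.obj X).L (Sum.inr (π X w)))) ∧
      (∀ (X : FinSubextCat F₁ K₁) (w : FinitePlace X.L),
        (FrdI.Cor54Sub.rlfIso
            (ModelFrobenioid.toElem (arithDivisorFunctor F₁ K₁) (unitsFunctor F₁ K₁) (divNatTrans F₁ K₁)) hΦ₁
            (ModelFrobenioid.toElem (arithDivisorFunctor F₂ K₂) (unitsFunctor F₂ K₂) (divNatTrans F₂ K₂)) hΦ₂ E).iso X
            (((toRlfNatTrans (arithDivisorFunctor F₁ K₁) (PreFrobenioid.IsPerfFactorialOn.op hΦ₁)).app (op X)).hom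
              (Multiplicative.ofAdd (EffArithDivisor.single X.L (Sum.inr w)))) =
          ((toRlfNatTrans (arithDivisorFunctor F₂ K₂) (PreFrobenioid.IsPerfFactorialOn.op hΦ₂)).app
              (op (ΨBase.obj X))).hom
            (Multiplicative.ofAdd (EffArithDivisor.single (ΨBase.obj X).L (Sum.inr (π X w))))) ∧
      (∀ ⦃A B⦄ (φ : A ⟶ B),
        (FrdI.Cor54Sub.rlfData
            (ModelFrobenioid.toElem (arithDivisorFunctor F₂ K₂) (unitsFunctor F₂ K₂) (divNatTrans F₂ K₂)) hΦ₂).degFr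
            (Ψrlf.map φ) =
          (FrdI.Cor54Sub.rlfData
            (ModelFrobenioid.toElem (arithDivisorFunctor F₁ K₁) (unitsFunctor F₁ K₁) (divNatTrans F₁ K₁)) hΦ₁).degFr φ) ∧
      ∀ ⦃A B⦄ (φ : A ⟶ B),
        (FrdI.Cor54Sub.rlfData
            (ModelFrobenioid.toElem (arithDivisorFunctor F₂ K₂) (unitsFunctor F₂ K₂) (divNatTrans F₂ K₂)) hΦ₂).div
            (Ψrlf.map φ) =
          (FrdI.Cor54Sub.rlfData
            (ModelFrobenioid.toElem (arithDivisorFunctor F₂ K₂) (unitsFunctor F₂ K₂) (divNatTrans F₂ K₂)) hΦ₂).pull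
            (ηrlf.hom.app A)
            ((FrdI.Cor54Sub.rlfIso
              (ModelFrobenioid.toElem (arithDivisorFunctor F₁ K₁) (unitsFunctor F₁ K₁) (divNatTrans F₁ K₁)) hΦ₁
              (ModelFrobenioid.toElem (arithDivisorFunctor F₂ K₂) (unitsFunctor F₂ K₂) (divNatTrans F₂ K₂)) hΦ₂ E).iso
              ((FrdI.Cor54Sub.rlfData
                (ModelFrobenioid.toElem (arithDivisorFunctor F₁ K₁) (unitsFunctor F₁ K₁) (divNatTrans F₁ K₁))
                hΦ₁).base.obj A)
              ((FrdI.Cor54Sub.rlfData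
                (ModelFrobenioid.toElem (arithDivisorFunctor F₁ K₁) (unitsFunctor F₁ K₁) (divNatTrans F₁ K₁))
                hΦ₁).div φ)) := by
  obtain ⟨ΨBase, E, η, π, hEq, -, hgen, hdiv⟩ := exists_transport_of_cor411iv Ψ h411iv
  haveI := hEq
  -- C54/L03: `Ψ^Φ` carries `Φ₁^birat` onto `Φ₂^birat`
  have hBC := arith_biratCompat_of_cor411iv Ψ E η hdiv
  -- C54/L02 + L04: `(Ψ^Φ)^rlf` extends `Ψ^Φ` and carries the real spans onto each other
  let Erlf := FrdI.Cor54Sub.rlfIso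
    (ModelFrobenioid.toElem (arithDivisorFunctor F₁ K₁) (unitsFunctor F₁ K₁) (divNatTrans F₁ K₁)) hΦ₁
    (ModelFrobenioid.toElem (arithDivisorFunctor F₂ K₂) (unitsFunctor F₂ K₂) (divNatTrans F₂ K₂)) hΦ₂ E
  have hover := FrdI.Cor54Sub.rlfIso_toRlf
    (ModelFrobenioid.toElem (arithDivisorFunctor F₁ K₁) (unitsFunctor F₁ K₁) (divNatTrans F₁ K₁)) hΦ₁
    (ModelFrobenioid.toElem (arithDivisorFunctor F₂ K₂) (unitsFunctor F₂ K₂) (divNatTrans F₂ K₂)) hΦ₂ E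
  have hspan := FrdI.Cor54Sub.realSpanCompat_holds
    (ModelFrobenioid.toElem (arithDivisorFunctor F₁ K₁) (unitsFunctor F₁ K₁) (divNatTrans F₁ K₁)) hΦ₁
    (ModelFrobenioid.toElem (arithDivisorFunctor F₂ K₂) (unitsFunctor F₂ K₂) (divNatTrans F₂ K₂)) hΦ₂ E Erlf
    hBC hover
  -- C54/L05: the model-level `Ψ^rlf` over the EQUIVALENCE `Ψ^Base`
  obtain ⟨Ψrlf, ηrlf, hEq', hdeg', hdiv'⟩ :=
    FrdI.Cor54Sub.rlfTransport_holds hΦ₁ hΦ₂ ΨBase.asEquivalence Erlf hspan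
  refine ⟨ΨBase, E, η, π, Ψrlf, ηrlf, hEq, hEq', hgen, fun X w => ?_, hdeg', hdiv'⟩
  rw [hover]
  exact congrArg _ (hgen X w)

end Arith

end Literature.AlgebraicGeometry.Frobenioids

end
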